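import Summits.CriticalPhenomena.PercolationContinuityZ3.Theorems.PercNearOneGluingNoHeavyQuantGluedWindowFarTop
import Summits.CriticalPhenomena.PercolationContinuityZ3.Theorems.PercNearOneGluingNoHeavyQuantGluedWindowDiagLightBig
import HarnessLib

/-!
# QUANT lane R8, T-DEC: LEMMA W's pair condition — the two-row h-mid regime with the TOP COPY UNREACHABLE (`2l + r + k ≤ T`), the pair heavy or
# incompatible at the glued target (`y(h−l) ≤ T−2l`), the middle copy reaching `h` (`T < l + r + h`), its partner `h + r` a mid (`h + r ≤ j`) and LIGHT
# for it (`T − 2(l+r) < y(h−l)`): the DIAGONAL certificate, by `diag_lightMinus` / `diag_lightPlus` (arm-1 gen 62, architect)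

builds on p205010 (kernel theorem, internal audit signed; external expert review pending)

Support file (`--supports stmt-CriticalPhenomena-4575`), QUANT lane seat prim-quant-arm-1 (gen 62, architect); memo
`run/shared/lean/prim/quant/prim-quant-arm-1-g62/ARCH-G62.md` §1–§3.  Theorems only; standard axioms, no sorries, no definitions.

THE CELL.  Companion of `…QuantGluedWindowNoTopHeavy` (p641292: `h+r` heavy for the middle copy): here `h + r ≤ j` is LIGHT for the middle copy
(`ρ_1 = (T−2l−2r)/(h−l) < y`).  Certificate (DIAGONAL): row `l` ↦ all of `h` at the exact heavy power (nothing if incompatible), row `l+r` ↦ all of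
`h+r` at the exact LIGHT power `(1−G₁)/G₁`, `G₁ = y² + (1−y)ρ_1`, remainders ↦ the giant `h+r+k`.  Inequalities (a-free reduction, memo §2):
`ρ_1 ≤ ρ₀` (the middle copy needs less than its column): `diag_lightMinus` from (c12) `t₀ν + t₁(ν−ε) ≤ ρ₀` [top copy unreachable, `a ≤ 1`] and (c13)
`ε(1+t₂) ≤ νt₂` [band1, band2, `x ≤ qg`]; `ρ₀ < ρ_1`: `diag_lightPlus` from (c11) `(1−y)(ν−ε) ≤ ρ₀` [band2] and (c12).
**`gluedPullback_windowPair_twoRow_noTop_lightG`**: the pair condition `(1−γ)Ψ(l) + γΨ(h) ≤ 0`, no `GluedLemmaW`, no further hypothesis.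

HONEST STATUS.  `GluedLemmaW` (flow form), `GluedDominatedMass`, the band, `SiblingStep`, `FarTreeRow` OPEN; RATE class (log\*) / honest sentence of
`run/shared/lean/prim/quant/README.md` unchanged.  [this work].  Nothing here is cited as a published result.  The gluing rows served
[cite: KozmaNitzan2024, Conjecture 3 (p. 15)]; product measure [cite: Grimmett1999, §1.3 p. 10].
-/

set_option maxHeartbeats 4000000

noncomputable section

namespace Summit.CriticalPhenomena.PercolationContinuityZ3.Theorems
namespace Quant
namespace LawDec

/-- **TWO-ROW REGIME, h MID, TOP COPY UNREACHABLE, SECOND COPY LIGHT**: `2l + r + k ≤ T`, `y(h−l) ≤ T−2l`, `T < l + r + h`, `h + r ≤ j`,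
`T − 2(l+r) < y(h−l)` ⟹ `(1−γ)Ψ(l) + γΨ(h) ≤ 0` for every price system and every cheap `c ≥ h` (the diagonal certificate). [this work] -/
theorem gluedPullback_windowPair_twoRow_noTop_lightG (x a q g S : ℝ) (B r k j l h c ls : ℕ) (α p : ℕ → ℝ)
    (hx0 : 0 < x) (hx1 : x < 1) (ha0 : 0 < a) (ha1 : a ≤ 1) (hq0 : 0 < q) (hq1 : q < 1) (hg0 : 0 ≤ g) (hg1 : g ≤ 1) (hr : 1 ≤ r)
    (hxqg : x ≤ q * g) (hband1 : 2 * (r : ℝ) < q * ((r : ℝ) + k * g)) (hband2 : q * ((r : ℝ) + k * g) - r < (k : ℝ) * x)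
    (hlh : l < h) (hhB : h ≤ B) (hhj : h ≤ j) (hwin : j < h + r + k) (hlow : 2 * (l : ℝ) < a * S) (hcomp : a * S < (l : ℝ) + h)
    (hlight : pairGate (a * x) (a * S) l h < a * x)
    (hL2j : l + r + k ≤ j) (hL2mid : a * (S + q * ((r : ℝ) + k * g)) ≤ 2 * ((l : ℝ) + r + k))
    (hL1low : 2 * ((l : ℝ) + r) < a * (S + q * ((r : ℝ) + k * g))) (hhmid : a * (S + q * ((r : ℝ) + k * g)) ≤ 2 * (h : ℝ))
    (hincl : 2 * (l : ℝ) + r + k ≤ a * (S + q * ((r : ℝ) + k * g)))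
    (hheavyT : (a * x) * ((h : ℝ) - l) ≤ a * (S + q * ((r : ℝ) + k * g)) - 2 * (l : ℝ))
    (hcompat1 : a * (S + q * ((r : ℝ) + k * g)) < (l : ℝ) + r + h) (hjr : h + r ≤ j)
    (hGlight : a * (S + q * ((r : ℝ) + k * g)) - 2 * ((l : ℝ) + r) < (a * x) * ((h : ℝ) - l))
    (hhc : h ≤ c) (hcB : c ≤ B) (hcj : c ≤ j)
    (hp : ∀ h, 0 ≤ p h)
    (hαp : ∀ l' h', l' ≤ j → 2 * (l' : ℝ) < a * (S + q * ((r : ℝ) + k * g)) → h' ≤ B + (r + k) →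
      (j + 1 ≤ h' ∨ a * (S + q * ((r : ℝ) + k * g)) < (l' : ℝ) + h') →
      α l' ≤ usage (a * x) (a * (S + q * ((r : ℝ) + k * g))) j l' h' * p h')
    (hcheap : -(gluedPullback (a * (S + q * ((r : ℝ) + k * g))) q g j r k α p c) * (a * x)
      < (1 - a * x) * gluedPullback (a * (S + q * ((r : ℝ) + k * g))) q g j r k α p ls) :
    (1 - pairGate (a * x) (a * S) l h) * gluedPullback (a * (S + q * ((r : ℝ) + k * g))) q g j r k α p l
      + pairGate (a * x) (a * S) l h * gluedPullback (a * (S + q * ((r : ℝ) + k * g))) q g j r k α p h ≤ 0 := by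
  obtain ⟨y, hy⟩ : ∃ y : ℝ, y = a * x := ⟨_, rfl⟩
  obtain ⟨T, hT⟩ : ∃ T : ℝ, T = a * (S + q * ((r : ℝ) + k * g)) := ⟨_, rfl⟩
  obtain ⟨T₀, hT₀⟩ : ∃ T₀ : ℝ, T₀ = a * S := ⟨_, rfl⟩
  have hy0 : 0 < y := by rw [hy]; exact mul_pos ha0 hx0
  have hyx : y ≤ x := by rw [hy]; nlinarith
  have hy1 : y < 1 := by linarith
  have h1y : 0 < 1 - y := by linarith
  obtain ⟨t1, ht1⟩ : ∃ t1 : ℝ, t1 = q * (1 - g) := ⟨_, rfl⟩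
  obtain ⟨t2, ht2⟩ : ∃ t2 : ℝ, t2 = q * g := ⟨_, rfl⟩
  have ht1p : 0 ≤ t1 := by rw [ht1]; exact mul_nonneg hq0.le (by linarith)
  have ht2p : 0 ≤ t2 := by rw [ht2]; exact mul_nonneg hq0.le hg0
  have et0 : 1 - t1 - t2 = 1 - q := by rw [ht1, ht2]; ring
  have ht0p : 0 ≤ 1 - t1 - t2 := by rw [et0]; linarith
  have hyt2 : y ≤ t2 := by rw [ht2]; linarith
  have hr1 : (1:ℝ) ≤ r := by exact_mod_cast hr
  have hr0 : (0:ℝ) ≤ r := by linarith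
  have hk0 : (0:ℝ) ≤ k := Nat.cast_nonneg k
  have hlh' : (l : ℝ) < h := by exact_mod_cast hlh
  -- geometry: d = h − l, N = T − 2l, A = T − T₀ ≤ m = t1 r + t2 (r+k) ≤ t1 r + t2 N
  obtain ⟨d, hd⟩ : ∃ d : ℝ, d = (h : ℝ) - l := ⟨_, rfl⟩
  have hd0 : 0 < d := by rw [hd]; linarith
  obtain ⟨N, hN⟩ : ∃ N : ℝ, N = T - 2 * (l : ℝ) := ⟨_, rfl⟩
  have hA : T - T₀ = a * (q * ((r : ℝ) + k * g)) := by rw [hT, hT₀]; ring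
  have em : q * (1 - g) * (r : ℝ) + q * g * ((r : ℝ) + k) = q * ((r : ℝ) + k * g) := by ring
  have hAm : T - T₀ ≤ t1 * r + t2 * ((r : ℝ) + k) := by
    rw [hA, ht1, ht2]
    have h1 : a * (q * ((r : ℝ) + k * g)) ≤ 1 * (q * ((r : ℝ) + k * g)) :=
      mul_le_mul_of_nonneg_right ha1 (by positivity)
    linarith [h1, em]
  have hNK : (r : ℝ) + k ≤ N := by rw [hN, hT]; linarith              -- row l NOT compatible with A
  have hNyd : y * d ≤ N := by rw [hN, hd, hT, hy]; exact hheavyT       -- heavy (or incompatible) at T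
  have hNdr : N < d + r := by rw [hN, hd, hT]; linarith [hcompat1]      -- middle copy compatible with h
  have h2rN : 2 * (r : ℝ) < N := by rw [hN, hT]; linarith
  have hN0 : 0 < N := by linarith
  have hAN : T - T₀ ≤ t1 * r + t2 * N := by nlinarith [hAm, mul_le_mul_of_nonneg_left hNK ht2p]
  -- the light gate of the first factor
  obtain ⟨ρ₀, hρ₀⟩ : ∃ ρ₀ : ℝ, ρ₀ = (T₀ - 2 * (l : ℝ)) / ((h : ℝ) - l) := ⟨_, rfl⟩
  have hρ₀y : ρ₀ < y := by
    have : (T₀ - 2 * (l : ℝ)) / ((h : ℝ) - l) ≤ pairGate y T₀ l h := le_max_left _ _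
    rw [hρ₀]; rw [hy, hT₀] at this ⊢; linarith
  obtain ⟨γ, hγ⟩ : ∃ γ : ℝ, γ = y ^ 2 + (1 - y) * ρ₀ := ⟨_, rfl⟩
  have hγ' : pairGate (a * x) (a * S) l h = γ := by
    rw [hγ, hρ₀, hT₀, hy]; exact pairGate_eq_light (a * x) (a * S) l h (mul_pos ha0 hx0).le (by rw [← hy, ← hT₀, ← hρ₀]; exact hρ₀y.le)
  have eρ₀ : ρ₀ = (N - (T - T₀)) / d := by rw [hρ₀, hN, hd]; congr 1; ring
  have hρ₀0 : 0 < ρ₀ := by rw [hρ₀]; exact div_pos (by rw [hT₀]; linarith) (by linarith)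
  have hγ0 : 0 < γ := by rw [hγ]; positivity
  have hγy : γ < y := by rw [hγ]; nlinarith [mul_lt_mul_of_pos_left hρ₀y h1y]
  have h1γ : 0 < 1 - γ := by linarith
  have hlowl : 2 * (l : ℝ) < T := by linarith
  have eLr : ((l + r : ℕ) : ℝ) = (l : ℝ) + r := by push_cast; ring
  have eHr : ((h + r : ℕ) : ℝ) = (h : ℝ) + r := by push_cast; ring
  have hlowlr : 2 * ((l + r : ℕ) : ℝ) < T := by rw [eLr]; linarith
  -- box coordinates ν = N/d ≥ y, ρ_1 = (N − 2r)/d < y, ε = r/d; the band facts (c11), (c12), (c13)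
  obtain ⟨nu, hnu⟩ : ∃ nu : ℝ, nu = N / d := ⟨_, rfl⟩
  obtain ⟨r1, hr1d⟩ : ∃ r1 : ℝ, r1 = (N - 2 * (r : ℝ)) / d := ⟨_, rfl⟩
  obtain ⟨ee, hee⟩ : ∃ ee : ℝ, ee = (r : ℝ) / d := ⟨_, rfl⟩
  have hnuy : y ≤ nu := by rw [hnu, le_div_iff₀ hd0]; exact hNyd
  have hn0 : 0 < nu := lt_of_lt_of_le hy0 hnuy
  have hr1y : r1 < y := by rw [hr1d, div_lt_iff₀ hd0, hN, hd, hy, hT]; linarith [hGlight]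
  have hr10 : 0 < r1 := by rw [hr1d]; exact div_pos (by linarith) hd0
  have enr : nu - ee = (nu + r1) / 2 := by rw [hnu, hee, hr1d]; field_simp; ring
  have eρ₀d : ρ₀ * d = N - (T - T₀) := by rw [eρ₀, div_mul_cancel₀ _ hd0.ne']
  have eN : nu * d = N := by rw [hnu, div_mul_cancel₀ _ hd0.ne']
  have er : ee * d = r := by rw [hee, div_mul_cancel₀ _ hd0.ne']
  have hc12 : (1 - t1 - t2) * nu + t1 * (nu - ee) ≤ ρ₀ := by
    have h1 : ((1 - t1 - t2) * nu + t1 * (nu - ee)) * d ≤ ρ₀ * d := by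
      have e : ((1 - t1 - t2) * nu + t1 * (nu - ee)) * d = (1 - t1 - t2) * (nu * d) + t1 * (nu * d - ee * d) := by ring
      rw [e, eN, er, eρ₀d]; linarith [hAN]
    exact le_of_mul_le_mul_right h1 hd0
  -- band2: A = a m < k y + a r ≤ (N − r) y + r, so ρ₀ d = N − A > (N − r)(1 − y)
  have hc11 : (1 - y) * (nu - ee) ≤ ρ₀ := by
    have hb : a * (q * ((r : ℝ) + k * g) - r) < a * ((k : ℝ) * x) := mul_lt_mul_of_pos_left hband2 ha0
    have hkN : (k : ℝ) ≤ N - r := by linarith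
    have har : a * (r : ℝ) ≤ r := mul_le_of_le_one_left hr0 ha1
    have hky : (k : ℝ) * y ≤ (N - r) * y := mul_le_mul_of_nonneg_right hkN hy0.le
    have h1 : T - T₀ < (N - r) * y + r := by
      have e1 : a * (q * ((r : ℝ) + k * g) - r) = (T - T₀) - a * r := by rw [hA]; ring
      have e2 : a * ((k : ℝ) * x) = (k : ℝ) * y := by rw [hy]; ring
      linarith [hb, har, hky, e1, e2]
    have h2 : ((1 - y) * (nu - ee)) * d ≤ ρ₀ * d := by
      have e : ((1 - y) * (nu - ee)) * d = (1 - y) * (nu * d - ee * d) := by ring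
      rw [e, eN, er, eρ₀d]; nlinarith [h1]
    exact le_of_mul_le_mul_right h2 hd0
  -- band1 + band2 + x ≤ qg: r < m − r < k x ≤ (N − r) t2
  have hc13 : ee * (1 + t2) ≤ nu * t2 := by
    have h1 : (r : ℝ) < (k : ℝ) * x := by linarith
    have h2 : (k : ℝ) * x ≤ (N - r) * t2 := by
      rw [ht2]; exact mul_le_mul (by linarith) hxqg hx0.le (by linarith)
    have h3 : (ee * (1 + t2)) * d ≤ (nu * t2) * d := by
      have e1 : (ee * (1 + t2)) * d = ee * d * (1 + t2) := by ring
      have e2 : (nu * t2) * d = nu * d * t2 := by ring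
      have e3 : (N - r) * t2 = N * t2 - r * t2 := by ring
      rw [e1, e2, eN, er]; nlinarith [h1, h2, e3, mul_nonneg hr0 ht2p]
    exact le_of_mul_le_mul_right h3 hd0
  have hs1 : (1 - t1 - t2) + t1 ≤ 1 - y := by linarith
  -- powers: pool pu, row l+r into h+r (pG, exact LIGHT power), row l into h (ph or 0)
  obtain ⟨pu, hpu⟩ : ∃ pu : ℝ, pu = (1 - y) / y := ⟨_, rfl⟩
  have hpu0 : 0 < pu := by rw [hpu]; exact div_pos h1y hy0
  have vP : pu * (y / (1 - y)) ≤ 1 := by rw [hpu, div_mul_div_comm, mul_comm (1 - y) y, div_self (mul_ne_zero hy0.ne' h1y.ne')]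
  obtain ⟨G1, hG1⟩ : ∃ G1 : ℝ, G1 = y ^ 2 + (1 - y) * r1 := ⟨_, rfl⟩
  have hG1y : G1 ≤ y := by rw [hG1]; nlinarith [mul_le_mul_of_nonneg_left hr1y.le h1y.le]
  have hG10 : 0 < G1 := by rw [hG1]; positivity
  have hG11 : 0 < 1 - G1 := by linarith
  obtain ⟨pG, hpG⟩ : ∃ pG : ℝ, pG = (1 - G1) / G1 := ⟨_, rfl⟩
  have hpG0 : 0 ≤ pG := by rw [hpG]; exact div_nonneg hG11.le hG10.le
  have hGcomp : T < ((l + r : ℕ) : ℝ) + ((h + r : ℕ) : ℝ) := by rw [eLr, eHr]; rw [hN, hd] at hNdr; linarith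
  have vG : pG * usage y T j (l + r) (h + r) ≤ 1 := by
    have er1 : (T - 2 * ((l + r : ℕ) : ℝ)) / ((((h + r : ℕ) : ℝ)) - ((l + r : ℕ) : ℝ)) = r1 := by
      rw [hr1d, eLr, eHr, hN, hd]; congr 1 <;> ring
    have vlt : ((l + r : ℕ) : ℝ) < ((h + r : ℕ) : ℝ) := by rw [eLr, eHr]; linarith
    have hl' : T - 2 * ((l + r : ℕ) : ℝ) ≤ y * ((((h + r : ℕ) : ℝ)) - ((l + r : ℕ) : ℝ)) := by
      rw [eLr, eHr, show (h : ℝ) + r - ((l : ℝ) + r) = (h : ℝ) - l by ring]; rw [hy, hT]; linarith [hGlight]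
    have e := GluedWindow.apow_light_exact_valid y T 1 j (l + r) (h + r) hy0 hy1 hjr hlowlr vlt hl'
    rw [er1, ← hG1, ← hpG, one_mul] at e
    exact e.le
  have eL1 : (1 - γ) * t1 - γ * t1 * pG = t1 * (1 - γ / G1) := by rw [hpG]; field_simp; ring
  -- row l into h: power ph with leftover between 0 and t0 (1 − γ/ν)
  have hγn : γ / nu ≤ 1 := by rw [div_le_one hn0]; linarith
  obtain ⟨ph, hph0, vH, hcH, hL0, hL0'⟩ : ∃ ph : ℝ, 0 ≤ ph ∧ ph * usage y T j l h ≤ 1 ∧ (ph = 0 ∨ T < (l : ℝ) + h) ∧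
      0 ≤ (1 - γ) * (1 - t1 - t2) - γ * (1 - t1 - t2) * ph ∧
      (1 - γ) * (1 - t1 - t2) - γ * (1 - t1 - t2) * ph ≤ (1 - t1 - t2) * (1 - γ / nu) := by
    by_cases hNd : N < d
    · have hcompa : T < (l : ℝ) + h := by rw [hN, hd] at hNd; linarith
      have eph : ((l : ℝ) + h - T) / (T - 2 * (l : ℝ)) = (1 - nu) / nu := by
        rw [hnu, show (l : ℝ) + h - T = d - N by rw [hd, hN]; ring, ← hN, one_sub_div hd0.ne', div_div_div_cancel_right₀ hd0.ne']
      have e2 : (1 - γ) * (1 - t1 - t2) - γ * (1 - t1 - t2) * ((1 - nu) / nu) = (1 - t1 - t2) * (1 - γ / nu) := by field_simp; ring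
      refine ⟨((l : ℝ) + h - T) / (T - 2 * (l : ℝ)), div_nonneg (by linarith) (by linarith), ?_, Or.inr hcompa, ?_, ?_⟩
      · have e := GluedWindow.apow_heavy_valid y T 1 j l h hy0 hy1 hhj hlowl hcompa (by rw [← hN, ← hd]; exact hNyd)
        rw [one_mul] at e; exact e.le
      · rw [eph, e2]; exact mul_nonneg ht0p (by linarith)
      · rw [eph, e2]
    · refine ⟨0, le_rfl, by rw [zero_mul]; exact zero_le_one, Or.inl rfl, ?_, ?_⟩
      · rw [mul_zero, sub_zero]; exact mul_nonneg h1γ.le ht0p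
      · have hn1 : 1 ≤ nu := by rw [hnu, le_div_iff₀ hd0]; linarith
        have : γ / nu ≤ γ := by rw [div_le_iff₀ hn0]; exact le_mul_of_one_le_right hγ0.le hn1
        rw [mul_zero, sub_zero, mul_comm]
        exact mul_le_mul_of_nonneg_left (by linarith) ht0p
  -- the main inequality: leftover0 + max(leftover1, 0) ≤ γ t2 pu
  have hCpos : 0 < γ * t2 * pu := by
    have : 0 < t2 := lt_of_lt_of_le hy0 hyt2
    positivity
  have epu : t2 * γ * ((1 - y) / y) = γ * t2 * pu := by rw [hpu]; ring
  have main : (1 - t1 - t2) * (1 - γ / nu) + max (t1 * (1 - γ / G1)) 0 ≤ γ * t2 * pu := by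
    by_cases hcase : r1 ≤ ρ₀
    · -- the middle copy needs less than its column: diag_lightMinus
      have hneg : t1 * (1 - γ / G1) ≤ 0 := by
        refine mul_nonpos_of_nonneg_of_nonpos ht1p ?_
        have : G1 ≤ γ := by rw [hG1, hγ]; nlinarith [mul_le_mul_of_nonneg_left hcase h1y.le]
        rw [sub_nonpos, le_div_iff₀ hG10]; linarith
      rw [max_eq_right hneg, add_zero]
      have core := diag_lightMinus y ρ₀ (1 - t1 - t2) t1 nu ee hy0 hy1 hρ₀0 hρ₀y.le ht0p ht1p
        (by rw [show 1 - (1 - t1 - t2) - t1 = t2 by ring]; exact hyt2) hnuy hc12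
        (by rw [show 1 - (1 - t1 - t2) - t1 = t2 by ring]; exact hc13)
      rw [← hγ, show 1 - (1 - t1 - t2) - t1 = t2 by ring, epu] at core
      exact core
    · -- the middle copy not lighter than the pair at T₀: diag_lightPlus
      have hcase' : ρ₀ ≤ r1 := (lt_of_not_ge hcase).le
      have e1 : (1 - y) * (nu + r1) = 2 * ((1 - y) * (nu - ee)) := by rw [enr]; ring
      have e2 : 2 * (1 - t1 - t2) * nu + t1 * (nu + r1) = 2 * ((1 - t1 - t2) * nu + t1 * (nu - ee)) := by rw [enr]; ring
      have core := diag_lightPlus y ρ₀ r1 (1 - t1 - t2) t1 nu hy0 hy1 hρ₀0 hcase' hr1y.le hnuy ht0p ht1p hs1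
        (by rw [e1]; linarith [hc11]) (by rw [e2]; linarith [hc12])
      rw [← hγ, ← hG1, show 1 - (1 - t1 - t2) - t1 = t2 by ring, epu] at core
      have h0 : 0 ≤ t1 * (1 - γ / G1) := by
        refine mul_nonneg ht1p ?_
        have : γ ≤ G1 := by rw [hG1, hγ]; nlinarith [mul_le_mul_of_nonneg_left hcase' h1y.le]
        rw [sub_nonneg, div_le_one hG10]; exact this
      rw [max_eq_left h0]; exact core
  obtain ⟨σ, hσ0, hσ1, hc0, hc1⟩ := diag_share ((1 - γ) * (1 - t1 - t2) - γ * (1 - t1 - t2) * ph) ((1 - γ) * t1 - γ * t1 * pG)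
    (γ * t2 * pu) hCpos hL0 (by linarith [main, hL0', le_max_right (t1 * (1 - γ / G1)) 0])
    (by rw [eL1]; linarith [main, hL0', le_max_left (t1 * (1 - γ / G1)) 0])
  -- the reduction theorem
  have h1σ : 0 ≤ 1 - σ := by linarith
  refine gluedPullback_windowPair_twoRow_mid_of_assign x a q g S B r k j l h c ls α p 0 0 ph 0 pu 0 0 pG pu
    0 1 0 σ 0 0 1 (1 - σ)
    hx0 hx1 ha0 ha1 hq0 hq1 hg0 hg1 hr hlh hhB hwin hlow hcomp hL2j hL2mid hL1low hhmid (Or.inl ⟨hjr, rfl⟩) hhc hcB hcj hp hαp hcheap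
    le_rfl hph0 le_rfl hpu0.le le_rfl le_rfl hpG0 hpu0.le le_rfl zero_le_one le_rfl hσ0 le_rfl le_rfl zero_le_one h1σ
    (by linarith) (by linarith) (by linarith) (by linarith)
    ?_ (Or.inl rfl) ?_ ?_ ?_ (Or.inl rfl) (Or.inl ?_) ?_ (Or.inl rfl) ?_ (Or.inl rfl) ?_ (Or.inr (Or.inr ?_)) (Or.inl ?_) ?_ ?_
  · rw [zero_mul]; exact zero_le_one
  · rw [← hy, ← hT]; exact vH
  · rw [← hT]; exact hcH
  · rw [zero_mul]; exact zero_le_one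
  · rw [← hy]; exact vP
  · rw [zero_mul]; exact zero_le_one
  · rw [zero_mul]; exact zero_le_one
  · rw [← hy, ← hT]; exact vG
  · rw [← hT, ← eHr]; rw [eLr] at hGcomp; exact hGcomp
  · rw [← hy]; exact vP
  · rw [hγ', ← ht1, ← ht2, ← et0]
    have e : 0 * ((1 - γ) * t2 * 0) + 1 * (γ * (1 - t1 - t2) * ph) + 0 * (γ * t1 * (1 - 0) * 0) + σ * (γ * (t2 + 0 * t1) * pu)
        = γ * (1 - t1 - t2) * ph + σ * (γ * t2 * pu) := by ring
    rw [e]; linarith [hc0]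
  · rw [hγ', ← ht1, ← ht2]
    have e : 0 * ((1 - γ) * t2 * 0) + 0 * (γ * (1 - q) * 0) + 1 * (γ * t1 * (1 - 0) * pG) + (1 - σ) * (γ * (t2 + 0 * t1) * pu)
        = γ * t1 * pG + (1 - σ) * (γ * t2 * pu) := by ring
    rw [e]; linarith [hc1]

end LawDec
end Quant
end Summit.CriticalPhenomena.PercolationContinuityZ3.Theorems
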